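import Mathlib
import Summits.ValiantsHypothesis.ValiantsHypothesis.Theorems.NewtonUnitEquationsDissociatedUniformTotalsLawUnion
import Summits.ValiantsHypothesis.ValiantsHypothesis.Theorems.NewtonUnitEquationsDissociatedUniformTotalsLawConvexUnion
import Summits.ValiantsHypothesis.ValiantsHypothesis.Theorems.NewtonUnitEquationsDissociatedUniformTotalsLawConvexUnionSharpness
import Summits.ValiantsHypothesis.ValiantsHypothesis.Theorems.NewtonUnitEquationsDissociatedUniformTotalsLawUnionEPRS
import HarnessLib

/-!
# Crux `NewtonUnitEquations.DissociatedUniform` (stmt-ValiantsHypothesis-5905): the `n = 3` totals law — the POINTWISE union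
# vertex bound for ARBITRARY labellings, typed and located

Companion of `…TotalsLawUnion` (`U_s(Z) = ⋃_{z∈Z} P_{s-z} ⊆ A + B`, `unionVert`, `unionTotal`, `@[conjecture] UnionTotalsLaw C`,
OPEN at `C = 2`), `…TotalsLawConvexUnion` (`@[conjecture] ConvexUnionVertBound C`: the pointwise bound `#vert conv U_s(W) ≤ C·q` on
the CONVEXLY ORDERED stratum; `C = 2` refuted by `…ConvexUnionSharpness`, `12q` proved for co-oriented pairs by `…LeftTurning`) and
`…TotalsLawUnionEPRS` (pointwise `48·q^{4/3}` for ARBITRARY labellings, by the Eisenbrand–Pach–Rothvoß–Sopher theorem).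

This file types the pointwise rung WITHOUT any hypothesis on the labelling:
* `@[conjecture] UnionVertBound C` : for every finite abelian `G`, all `a b : G → ℝ²`, every `Z ⊆ G` and every class `s`,
  `#vert conv U_s(Z) ≤ C·|G|`.  CENSUS (this seat, local exact integer hulls + annealing over `a, b, Z`, `4 ≤ q ≤ 16`;
  memo `Cruxes/DissociatedUniform/NOTES-t1g11.md`): `max #vert conv U = 3q − 1` for `q = 4, 5, 7, 8, 9`, `= 3q` at `q = 6`
  (`W = ℤ/6 ∖ {0,3}`), `≥ 28` at `q = 10`; never above `3q`.  So the located constant is `C = 3` (not excluded) and `C ≤ 2` is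
  FALSE in kernel (`not_unionVertBound_two`, from the `ℤ/4` witness `…ConvexUnionSharpness.CexFour.nine_le_unionVert`, `9 > 8`).
* What it buys BY NAME: `unionTotalsLaw_of_unionVertBound : UnionVertBound C → UnionTotalsLaw C` (hence the two-valued stratum of
  the `n = 3` law with `2C`, `twoValuedTotalsLaw_of_unionVertBound`), `classVert_le_of_unionVertBound` (an `m`-valued third curve
  gives `V_s ≤ m·C·|G|` POINTWISE), `convexUnionVertBound_of_unionVertBound` (it contains the convexly ordered rung).
* What is PROVED unconditionally around it: `unionVert ≤ |Z|·|G|` (`…TotalsLawUnion`), `≤ 2|G|` for cosets (`…UnionCosets`),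
  `O(w³)|G|` for `|G ∖ Z| = w` (`…UnionCoSmall`), `≤ 48|G|^{4/3}` always (`…UnionEPRS`), totals `(2 + 3w)|G|²` (`…TotalsLawExposure`);
  here in addition the trivial instances `unionVertBound_holds_of_card_le` (position sets of size `≤ C`).
Structural remark behind the census (memo §3): if `x₁, y₁` are the `θ`-tops of `A, B`, the `θ`-top `(x, y)` of `U_s(Z)` has
`x = x₁`, or `y = y₁`, or BOTH `x₁ + y` and `x + y₁` among the `|G ∖ Z|` missing fibres; in every extremal configuration found
the third kind is absent.
Honest label: a conjecture-grade statement typed and located, plus its by-name consequences; `UnionVertBound 3`, `UnionTotalsLaw 2`,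
`TwoValuedTotalsLaw`, `TotalsLawThree` remain OPEN.  Nothing here bears on VP ≠ VNP.
[folklore]
-/

set_option linter.dupNamespace false -- `ValiantsHypothesis.ValiantsHypothesis` (summit = problem) in every name

open scoped BigOperators Pointwise

namespace Summit.ValiantsHypothesis.ValiantsHypothesis.Theorems.NewtonUnitEquationsDissociatedUniform

namespace TotalsLaw

variable {G : Type*} [AddCommGroup G] [Fintype G]

/-- **The pointwise union vertex bound with constant `C`** (conjecture-grade, OPEN; census: `3q − 1` attained for `q = 4,…,9`,
`3q` at `q = 6`, never more, so `C = 3` is the located value; `C ≤ 2` is false): for every finite abelian `G`, all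
`a b : G → ℝ²`, every position set `Z` and every class `s`, the fibre union `U_s(Z) = ⋃_{z∈Z} P_{s-z}` has at most `C·|G|` hull
vertices.  Not asserted anywhere. -/
@[conjecture] def UnionVertBound (C : ℕ) : Prop :=
  ∀ (G : Type) [AddCommGroup G] [Fintype G] (a b : G → (Fin 2 → ℝ)) (Z : Set G) (s : G),
    unionVert a b Z s ≤ C * Fintype.card G

/-- Monotonicity in the constant. -/
theorem unionVertBound_mono {C C' : ℕ} (hCC' : C ≤ C') (h : UnionVertBound C) : UnionVertBound C' :=
  fun G _ _ a b Z s => (h G a b Z s).trans (Nat.mul_le_mul_right _ hCC')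

/-! ### What the pointwise bound buys -/

/-- **Pointwise ⇒ totals**: `UnionVertBound C → UnionTotalsLaw C` (sum over the `|G|` classes). -/
theorem unionTotalsLaw_of_unionVertBound {C : ℕ} (h : UnionVertBound C) : UnionTotalsLaw C := by
  intro H _ _ a b Z
  unfold unionTotal
  calc ∑ s, unionVert a b Z s ≤ ∑ _s : H, C * Fintype.card H := Finset.sum_le_sum fun s _ => h H a b Z s
    _ = C * Fintype.card H ^ 2 := by rw [Finset.sum_const, Finset.card_univ, smul_eq_mul]; ring

/-- Hence the two-valued stratum of the `n = 3` law with constant `2C`. -/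
theorem twoValuedTotalsLaw_of_unionVertBound {C : ℕ} (h : UnionVertBound C) : TwoValuedTotalsLaw (2 * C) :=
  twoValuedTotalsLaw_of_unionTotalsLaw (unionTotalsLaw_of_unionVertBound h)

/-- **Pointwise `n = 3` consequence**: an `m`-valued third curve gives `V_s ≤ m·C·|G|` for EVERY class (level-set decomposition
`…TotalsLawUnion.classVert_le_sum_unionVert`). -/
theorem classVert_le_of_unionVertBound {C : ℕ} (h : UnionVertBound C) {H : Type} [AddCommGroup H] [Fintype H]
    (a b c : H → (Fin 2 → ℝ)) (s : H) [DecidableEq (Fin 2 → ℝ)] {m : ℕ} (hm : (Finset.univ.image c).card ≤ m) :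
    classVert a b c s ≤ m * C * Fintype.card H := by
  calc classVert a b c s ≤ ∑ v ∈ Finset.univ.image c, unionVert a b (c ⁻¹' {v}) s := classVert_le_sum_unionVert a b c s
    _ ≤ ∑ _v ∈ Finset.univ.image c, C * Fintype.card H := Finset.sum_le_sum fun v _ => h H a b _ s
    _ = (Finset.univ.image c).card * (C * Fintype.card H) := by rw [Finset.sum_const, smul_eq_mul]
    _ ≤ m * (C * Fintype.card H) := Nat.mul_le_mul_right _ hm
    _ = m * C * Fintype.card H := (mul_assoc _ _ _).symm

/-- And the corresponding totals: an `m`-valued third curve gives `T(a,b,c) ≤ m·C·|G|²`. -/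
theorem totalVert_le_of_unionVertBound {C : ℕ} (h : UnionVertBound C) {H : Type} [AddCommGroup H] [Fintype H]
    (a b c : H → (Fin 2 → ℝ)) [DecidableEq (Fin 2 → ℝ)] {m : ℕ} (hm : (Finset.univ.image c).card ≤ m) :
    totalVert a b c ≤ m * C * Fintype.card H ^ 2 :=
  totalVert_le_of_unionTotalsLaw (unionTotalsLaw_of_unionVertBound h) a b c hm

/-- The general pointwise bound contains the convexly ordered rung: `UnionVertBound C → ConvexUnionVertBound C`. -/
theorem convexUnionVertBound_of_unionVertBound {C : ℕ} (h : UnionVertBound C) : ConvexUnionVertBound C := by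
  intro q _ a b _ _ W s
  simpa [ZMod.card] using h (ZMod q) a b (W : Set (ZMod q)) s

/-! ### Location: `C ≤ 2` is false, small position sets are trivial -/

/-- **`¬ UnionVertBound 2`**: the `ℤ/4` pair of census parabolas with one fibre removed has `9 > 8 = 2q` hull vertices
(`…ConvexUnionSharpness.CexFour.nine_le_unionVert`). -/
theorem not_unionVertBound_two : ¬ UnionVertBound 2 := by
  intro h
  have h8 := h (ZMod 4) CexFour.pA CexFour.pB (CexFour.posZ : Set (ZMod 4)) 2
  have h9 := CexFour.nine_le_unionVert
  rw [ZMod.card] at h8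
  omega

/-- Hence **`C ≥ 3` is necessary** in `UnionVertBound C` (the census value `C = 3` is not excluded). -/
theorem three_le_of_unionVertBound {C : ℕ} (h : UnionVertBound C) : 3 ≤ C := by
  by_contra hC
  exact not_unionVertBound_two (unionVertBound_mono (by omega) h)

/-- `UnionVertBound 0` fails already because a single fibre has a vertex. -/
theorem not_unionVertBound_zero : ¬ UnionVertBound 0 := fun h =>
  not_unionVertBound_two (unionVertBound_mono (Nat.zero_le 2) h)

/-- The trivial instances: position sets with at most `C` elements satisfy the bound with constant `C`
(`#vert conv U_s(Z) ≤ |Z|·|G|`, `…TotalsLawUnion.unionVert_le_card_mul`). -/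
theorem unionVertBound_holds_of_card_le {C : ℕ} (a b : G → (Fin 2 → ℝ)) (Z : Finset G) (hZ : Z.card ≤ C) (s : G) :
    unionVert a b (Z : Set G) s ≤ C * Fintype.card G :=
  (unionVert_le_card_mul a b Z s).trans (Nat.mul_le_mul_right _ hZ)

/-! ### The structural trichotomy of a top of a fibre union

At a direction in which `x₁` is the strict top of `A` and `y₁` the strict top of `B`, a top word `(x, y)` of `U_s(Z)` has
`x = x₁`, or `y = y₁`, or else both competitors `(x₁, y)` and `(x, y₁)` are MISSING from the union (their fibres `x₁ + y`,
`x + y₁` lie outside `s - Z`): stated below for an abstract weight as a pure bookkeeping lemma (no geometry). -/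

omit [Fintype G] in
/-- **Trichotomy of a top.**  If no allowed word (`s - x' - y' ∈ Z`) beats `(x, y)` for the weight `α x' + β y'` and `x₁`, `y₁`
beat every other letter strictly (`α x' < α x₁` for `x' ≠ x₁`, `β y' < β y₁` for `y' ≠ y₁`), then `x = x₁ ∨ y = y₁ ∨
(s - x₁ - y ∉ Z ∧ s - x - y₁ ∉ Z)`. [folklore] -/
theorem top_trichotomy (α β : G → ℝ) (Z : Set G) (s x y x₁ y₁ : G)
    (hmax : ∀ x' y' : G, s - x' - y' ∈ Z → α x' + β y' ≤ α x + β y)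
    (hx₁ : ∀ x' : G, x' ≠ x₁ → α x' < α x₁) (hy₁ : ∀ y' : G, y' ≠ y₁ → β y' < β y₁) :
    x = x₁ ∨ y = y₁ ∨ (s - x₁ - y ∉ Z ∧ s - x - y₁ ∉ Z) := by
  by_cases hx : x = x₁
  · exact Or.inl hx
  by_cases hy : y = y₁
  · exact Or.inr (Or.inl hy)
  refine Or.inr (Or.inr ⟨fun h => ?_, fun h => ?_⟩)
  · have h1 := hmax x₁ y h
    have h2 := hx₁ x hx
    linarith
  · have h1 := hmax x y₁ h
    have h2 := hy₁ y hy
    linarith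

omit [Fintype G] in
/-- **Dichotomy when ONE fibre is missing.**  If the allowed words are exactly those off the fibre `r₀`
(`s - x' - y' ∈ Z ↔ x' + y' ≠ r₀`), every top `(x, y)` has `x = x₁` or `y = y₁`: in the third case of `top_trichotomy` both
`x₁ + y = r₀` and `x + y₁ = r₀`, so the competitor `(x₁, y₁)` is allowed (else `y = y₁`) and beats `(x, y)`.  Hence the hull vertices
of `(A + B) ∖ P_{r₀}` are tops of `A` paired with something or tops of `B` paired with something (memo §3: `≤ 6q` of them on paper).
[folklore] -/
theorem top_dichotomy_of_one_missing (α β : G → ℝ) (r₀ s x y x₁ y₁ : G) (Z : Set G)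
    (hZ : ∀ x' y' : G, s - x' - y' ∈ Z ↔ x' + y' ≠ r₀)
    (hmax : ∀ x' y' : G, s - x' - y' ∈ Z → α x' + β y' ≤ α x + β y)
    (hx₁ : ∀ x' : G, x' ≠ x₁ → α x' < α x₁) (hy₁ : ∀ y' : G, y' ≠ y₁ → β y' < β y₁) :
    x = x₁ ∨ y = y₁ := by
  rcases top_trichotomy α β Z s x y x₁ y₁ hmax hx₁ hy₁ with h | h | ⟨h1, h2⟩
  · exact Or.inl h
  · exact Or.inr h
  · -- both competitors missing: `x₁ + y = r₀ = x + y₁`; then `(x₁, y₁)` is allowed unless `x₁ + y₁ = r₀`, i.e. `y = y₁`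
    by_cases hx : x = x₁
    · exact Or.inl hx
    by_cases hy : y = y₁
    · exact Or.inr hy
    exfalso
    have e1 : x₁ + y = r₀ := by by_contra hne; exact h1 ((hZ x₁ y).2 hne)
    have e2 : x + y₁ = r₀ := by by_contra hne; exact h2 ((hZ x y₁).2 hne)
    have hne11 : x₁ + y₁ ≠ r₀ := by
      intro e3
      apply hy
      have : y = y₁ := add_left_cancel (e1.trans e3.symm)
      exact this
    have h3 := hmax x₁ y₁ ((hZ x₁ y₁).2 hne11)
    have h4 := hx₁ x hx
    have h5 := hy₁ y hy
    linarith

end TotalsLaw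

end Summit.ValiantsHypothesis.ValiantsHypothesis.Theorems.NewtonUnitEquationsDissociatedUniform
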